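/-
Copyright (c) 2026 the pub-hodgecm-mathlib formalisation cell (harness21).  Prover seat hodgecm-mathlib-A-p19 (g19), topic T5 = P8
«(C♯)hol interior», row «T5-B(3b) COINVARIANT JUNCTION» (desk F0P2-plan (g8)), 2026-08-31.  KERNEL module: ONE theorem (the closer), no
definition, no named fact, no `sorry`, no instance, no notation.
-/
import Literature.NumberTheory.Automorphic.Liu2021.ThetaLiftFromLineFinIntertwiner
import Literature.NumberTheory.Automorphic.Liu2021.ThetaLiftFromLineFinComponent
import Summits.HodgeConjecture.HodgeConjecture.Theorems.F0P2aCohFormsContinuous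
import Summits.HodgeConjecture.HodgeConjecture.Theorems.F0P3HolProjectionReduction
import HarnessLib

/-!
# FLOOR-0 P2 · T5 = P8 «(C♯)hol interior», node B — THE LETTER ★ `Liu2021.meetsThetaLiftFromLine_hasFinComponent_rhoAtLine` (p826166) DISCHARGED:
# `theorem meetsThetaLiftFromLine_hasFinComponent_rhoAtLine_holds : Liu2021.meetsThetaLiftFromLine_hasFinComponent_rhoAtLine`

Cell hodgecm-mathlib (D-0151), FLOOR 0; crux item H413 = stmt-HodgeConjecture-24833 (route `HCCMUnconditional`); programme P2, topic T5 = P8 (`F0/P2/T5b-TREE.md`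
§8.2 node B «finite local–global»: steps (1)(2)(3a)(5) ★ typ-T5a∕T5b, (4) ★ p828276, (1b) ★ p828712 (B-p04 (g30)), (3b) ★ `ThetaLiftFromLineCoinvariantJunction` +
★ `ThetaLiftFromLineFinIntertwiner` (A-p19 (g19))).  THEOREMS ONLY; `--supports stmt-HodgeConjecture-24833`.  HC_CM is proved only modulo the printed citations —
the 2 remaining named inputs (hLiu418, h413) — until rung 0 closes; this file discharges ONE booked printed statement of the P2 book (node B of #87 (C♯)hol's interior).

## What is proved
`meetsThetaLiftFromLine_hasFinComponent_rhoAtLine_holds` — the named fact ★ `Literature.NumberTheory.Automorphic.Liu2021.meetsThetaLiftFromLine_hasFinComponent_rhoAtLine`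
([Liu2021, Prop. 4.13 proof Case 1, l. 2136–2137 «In other words … `π^∞ ≃ ω(μ, ε_e, χ)`»]; [Rallis1984, Thm. 1.2.2 proof]) HOLDS, BY NAME: for the discrete `P` of
`U(H)` (CM field `L`, `H` of signature `(2,1)` at `ι`, definite at the other complex places, `[L⁺:ℚ] ≥ 2`) meeting the global theta lift from the line `⟨a⟩` at the
`μ`-splitting and `H¹`-holomorphic at `ι`, `P.HasFinComponent (rhoAtLine … ιV a χ)` for some `χ ∈ Chi`.  PROOF = the Literature-side head ★
`MeetsThetaLiftFromLine.exists_hasFinComponent_rhoAtLine_of_holCotForm_of_coe` (the coinvariant junction, file 2∕2 of row T5-B(3b)) after the two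
Summit-side inputs Literature cannot import: (i) `CompactSpace [U(H)]` from definiteness (★ `F0P3HolProjectionReduction.compactSpace_automorphicQuotient_cm`,
Godement); (ii) `IsHolCotangentAt` ⇒ a non-zero holomorphic-cotangent COORDINATE CLASS in `P` (★ `F0P2aCohFormsContinuous.exists_toLp_ne_zero_of_mem_cohForms_cm`:
cotangent forms of the CM frame are continuous and `μA` is positive on opens).

## References
* [Liu2021] Y. Liu, Camb. J. Math. 9 (2021) = arXiv:2102.11518, proof of Prop. 4.13 Case 1 (l. 2131–2137, p. 48); Def. 4.11; App. D §D.1 Step 3, Lemma D.1.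
* [Rallis1984] S. Rallis, Compositio Math. 51 (1984), proof of Thm. 1.2.2 p. 356.  [GelbartRogawski1991] Invent. Math. 105 (1991), §3.2 p. 457.
* [BorelJacquet1979] A. Borel, H. Jacquet, PSPM 33.1, §4.1, §4.6.  [GelfandGraevPiatetskiShapiro1969] Ch. 1 §2.3 (compact quotient).
-/

set_option autoImplicit false

-- the mandated namespace has the single-problem summit's repeated segment (`HodgeConjecture.HodgeConjecture`)
set_option linter.dupNamespace false

noncomputable section

namespace Summit.HodgeConjecture.HodgeConjecture.Cruxes.H413.F0P2NodeBFinComponentHolds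

open MeasureTheory NumberField
open Literature.NumberTheory.Automorphic Literature.NumberTheory.Automorphic.UnitaryGroup
open Literature.NumberTheory.Automorphic.UnitaryGroup.CotangentForms
open Literature.NumberTheory.Automorphic.Liu2021
open Summit.HodgeConjecture.HodgeConjecture.Cruxes.H413

/-- **NODE B OF THE (C♯)hol INTERIOR HOLDS — ★ `Liu2021.meetsThetaLiftFromLine_hasFinComponent_rhoAtLine` (p826166) DISCHARGED BY NAME**
([Liu2021, Prop. 4.13 proof Case 1, «In other words … `π^∞ ≃ ω(μ, ε_e, χ)`»]): in the (C♯)hol frame, a discrete `P` of `U(H)` that meets the theta lift from the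
line `⟨a⟩` at the `μ`-splitting and is `H¹`-cohomological holomorphic at `ι` has finite component `ω(μ, ε_a, χ)_f = rhoAtLine … ιV a χ` for some `χ ∈ Chi`.
PROOF: `CompactSpace [U(H)]` (★ `compactSpace_automorphicQuotient_cm`, definiteness + `[L⁺:ℚ] ≥ 2`); `IsHolCotangentAt` gives a non-zero `Φ ∈ holCotForms` with
`P.ContainsForm Φ`, whence a non-zero coordinate CLASS `[Φ_j] ∈ P` (★ `exists_toLp_ne_zero_of_mem_cohForms_cm` over ★ `holCotForms_le_cohForms`); then ★
`MeetsThetaLiftFromLine.exists_hasFinComponent_rhoAtLine_of_holCotForm_of_coe` (the coinvariant junction: ★ (5) + ★ (1b) + the finite theta intertwiner + Schur).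
[cite: Liu2021, Prop. 4.13 proof Case 1 (l. 2136–2137, p. 48); Def. 4.11 (l. 2092–2096); App. D §D.1 Step 3 (l. 5221), Lemma D.1 (l. 5227)]
[cite: Rallis1984, Thm. 1.2.2 proof p. 356] [cite: GelbartRogawski1991, §3.2 p. 457] [cite: BorelJacquet1979, §4.6] -/
theorem meetsThetaLiftFromLine_hasFinComponent_rhoAtLine_holds :
    Literature.NumberTheory.Automorphic.Liu2021.meetsThetaLiftFromLine_hasFinComponent_rhoAtLine := by
  intro L _ _ _ ι H T hT hdef h2 n' e₁ dV hdV hdV0 g hg ιV hιV ιA hιA _ μA _ P μ hμ a hmeet hhol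
  haveI : CompactSpace (adelicGroupData (↥(maximalRealSubfield L)) L (IsCMField.complexConj L) 3 H).automorphicQuotient :=
    F0P3HolProjectionReduction.compactSpace_automorphicQuotient_cm hdef h2
  -- `IsHolCotangentAt`: a non-zero holomorphic cotangent form whose coordinate classes lie in `P`
  obtain ⟨Φ, hΦ, hne, hcont⟩ := hhol
  have hm : ∀ j : Fin 2,
      MemLp (toQuotFun (adelicGroupData (↥(maximalRealSubfield L)) L (IsCMField.complexConj L) 3 H) fun x => Φ x j) 2 μA :=
    fun j => (hcont j).choose
  -- some coordinate class is non-zero (continuity of cotangent forms, `μA` positive on opens)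
  obtain ⟨j, hj⟩ := F0P2aCohFormsContinuous.exists_toLp_ne_zero_of_mem_cohForms_cm (holCotForms_le_cohForms hΦ) hne hm
  exact hmeet.exists_hasFinComponent_rhoAtLine_of_holCotForm_of_coe L ι H T hT e₁ dV hdV hdV0 g hg μ hμ a P ιV hιV ιA hιA hΦ (hm j)
    (hcont j).choose_spec hj

end Summit.HodgeConjecture.HodgeConjecture.Cruxes.H413.F0P2NodeBFinComponentHolds

end
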